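import Literature.NumberTheory.Transcendental.KZRulesAssociator
import Summits.KontsevichZagierPeriods.KontsevichZagierPeriods.Theorems.GrothendieckKEAlgIndependent

/-!
# Route GenusOneIterated — support item `LemniscaticSectorKernel` (stmt-KontsevichZagierPeriods-8548),
# file 1: the sector-kernel engine

Pure algebra behind every "transcendence-isolated sector theorem" of the Kontsevich–Zagier calculus
(route `GenusOneIterated`, support item `LemniscaticSectorKernel`, stmt-8548; pattern of route
`Grothendieck`'s `LemniscaticSectorGlue`). Work in the formal period ring
`P = KZ.FormalPeriodRing = FormalRep ⧸ relations` (`KZRulesAssociator.lean`, a `CommRing`, quotient map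
`KZ.toFormalPeriod`, evaluation `KZ.evalP : P →+* ℝ`).

* `kernel_of_normalForms` — let `G ⊆ FormalRep` be a set of generators, `v : Fin 3 → P` three
  classes with real values `x = evalP ∘ v` ALGEBRAICALLY INDEPENDENT over `ℚ`, and suppose every
  generator `d ∈ G` has a NORMAL FORM `N • ⟦d⟧ = p(v)` (`0 < N ∈ ℕ`, `p ∈ ℤ[X₀, X₁, X₂]`). If
  `P` has no `ℤ`-torsion on the relevant classes (`TorsionFree`: `N ≠ 0`, `N • c ∈ relations ⇒
  c ∈ relations`), then every `c` in the (non-unital) subring generated by `G` whose value vanishes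
  is a relation: normal forms are stable under `+`, `−`, `·` (closure induction), `eval c = 0` forces
  `p(x) = 0`, hence `p = 0` by algebraic independence, hence `N • c ∈ relations`.
* `algebraicIndependent_of_mem_adjoin` — transfer of algebraic independence between two triples
  generating the same field (transcendence degree count, `Algebra.trdeg`; the counting lemma is
  route Grothendieck's `le_trdeg_adjoin_of_algebraicIndependent`, imported).

No definitions are introduced; pure proof file.

References: M. Kontsevich, D. Zagier, *Periods* (2001), §1.2 (Conjecture 1 in kernel form), §4.1
(the algebra of effective periods); A. Huber, S. Müller-Stach, *Periods and Nori Motives* (2017),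
§13.1.
-/

noncomputable section

open Literature.NumberTheory.Transcendental
open Literature.NumberTheory.Transcendental.KZ
open MvPolynomial (aeval X C)
open IntermediateField (adjoin)

namespace Summit.KontsevichZagierPeriods.GenusOneIterated.LemniscaticSectorKernel

/-! ## Evaluation of polynomial expressions in the formal period ring -/

/-- **`evalP ∘ aeval v = aeval (evalP ∘ v)`** on `ℤ[X₀, X₁, X₂]`: both sides are ring maps agreeing
on the variables. [Kontsevich–Zagier 2001, §4.1] -/
theorem evalP_aeval (v : Fin 3 → FormalPeriodRing) (p : MvPolynomial (Fin 3) ℤ) :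
    evalP (aeval v p) = aeval (fun i => evalP (v i)) p := by
  have h : (evalP.comp (aeval v : MvPolynomial (Fin 3) ℤ →ₐ[ℤ] FormalPeriodRing).toRingHom) =
      (aeval (fun i => evalP (v i)) : MvPolynomial (Fin 3) ℤ →ₐ[ℤ] ℝ).toRingHom := by
    refine MvPolynomial.ringHom_ext (fun z => ?_) (fun i => ?_)
    · simp
    · simp
  exact RingHom.congr_fun h p

/-! ## Normal forms are stable under the ring operations -/

/-- `0` has the normal form `1 • ⟦0⟧ = 0`. [folklore] -/
theorem hasNF_zero (v : Fin 3 → FormalPeriodRing) :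
    ∃ N : ℕ, N ≠ 0 ∧ ∃ p : MvPolynomial (Fin 3) ℤ,
      (N : FormalPeriodRing) * toFormalPeriod 0 = aeval v p :=
  ⟨1, one_ne_zero, 0, by simp⟩

/-- Normal forms add: `N⟦c⟧ = p(v)`, `M⟦d⟧ = q(v)` give `NM⟦c + d⟧ = (M p + N q)(v)`. [folklore] -/
theorem hasNF_add {v : Fin 3 → FormalPeriodRing} {c d : FormalRep}
    (hc : ∃ N : ℕ, N ≠ 0 ∧ ∃ p : MvPolynomial (Fin 3) ℤ,
      (N : FormalPeriodRing) * toFormalPeriod c = aeval v p)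
    (hd : ∃ N : ℕ, N ≠ 0 ∧ ∃ p : MvPolynomial (Fin 3) ℤ,
      (N : FormalPeriodRing) * toFormalPeriod d = aeval v p) :
    ∃ N : ℕ, N ≠ 0 ∧ ∃ p : MvPolynomial (Fin 3) ℤ,
      (N : FormalPeriodRing) * toFormalPeriod (c + d) = aeval v p := by
  obtain ⟨N, hN, p, hp⟩ := hc
  obtain ⟨M, hM, q, hq⟩ := hd
  refine ⟨N * M, mul_ne_zero hN hM, (M : MvPolynomial (Fin 3) ℤ) * p + (N : MvPolynomial (Fin 3) ℤ) * q,
    ?_⟩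
  rw [map_add, Nat.cast_mul, map_add, map_mul, map_mul, map_natCast, map_natCast, ← hp, ← hq]
  ring

/-- Normal forms negate. [folklore] -/
theorem hasNF_neg {v : Fin 3 → FormalPeriodRing} {c : FormalRep}
    (hc : ∃ N : ℕ, N ≠ 0 ∧ ∃ p : MvPolynomial (Fin 3) ℤ,
      (N : FormalPeriodRing) * toFormalPeriod c = aeval v p) :
    ∃ N : ℕ, N ≠ 0 ∧ ∃ p : MvPolynomial (Fin 3) ℤ,
      (N : FormalPeriodRing) * toFormalPeriod (-c) = aeval v p := by
  obtain ⟨N, hN, p, hp⟩ := hc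
  exact ⟨N, hN, -p, by rw [map_neg, mul_neg, hp, map_neg]⟩

/-- Normal forms multiply (the formal period ring is commutative): `NM⟦c d⟧ = (p q)(v)`. [folklore] -/
theorem hasNF_mul {v : Fin 3 → FormalPeriodRing} {c d : FormalRep}
    (hc : ∃ N : ℕ, N ≠ 0 ∧ ∃ p : MvPolynomial (Fin 3) ℤ,
      (N : FormalPeriodRing) * toFormalPeriod c = aeval v p)
    (hd : ∃ N : ℕ, N ≠ 0 ∧ ∃ p : MvPolynomial (Fin 3) ℤ,
      (N : FormalPeriodRing) * toFormalPeriod d = aeval v p) :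
    ∃ N : ℕ, N ≠ 0 ∧ ∃ p : MvPolynomial (Fin 3) ℤ,
      (N : FormalPeriodRing) * toFormalPeriod (c * d) = aeval v p := by
  obtain ⟨N, hN, p, hp⟩ := hc
  obtain ⟨M, hM, q, hq⟩ := hd
  refine ⟨N * M, mul_ne_zero hN hM, p * q, ?_⟩
  rw [map_mul, Nat.cast_mul, map_mul, ← hp, ← hq]
  ring

/-! ## The engine -/

/-- **The sector-kernel engine.** Let `G ⊆ FormalRep`, `v : Fin 3 → P` with algebraically
independent values `x i = evalP (v i)`, assume `TorsionFree` (`N ≠ 0`, `N • c ∈ relations ⇒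
c ∈ relations`) and that every `d ∈ G` has a normal form `N • ⟦d⟧ = p(v)`, `p ∈ ℤ[X₀,X₁,X₂]`,
`N ≠ 0`. Then Conjecture 1 holds in kernel form on the non-unital subring generated by `G`: every
`c ∈ closure G` with `eval c = 0` lies in `KZ.relations`. Proof: closure induction gives `c` a
normal form; applying `evalP` (soundness of the moves and Fubini are inside `evalP`) gives
`p(x) = N · eval c = 0`, so `p = 0` by algebraic independence (`ℤ`-coefficients pushed to `ℚ` by
`MvPolynomial.map_injective`), so `⟦N • c⟧ = 0`, i.e. `N • c ∈ relations`, and torsion-freeness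
concludes. [Kontsevich–Zagier 2001, §1.2, §4.1] -/
theorem kernel_of_normalForms {G : Set FormalRep} {v : Fin 3 → FormalPeriodRing} {x : Fin 3 → ℝ}
    (hv : ∀ i, evalP (v i) = x i) (hx : AlgebraicIndependent ℚ x)
    (hT : ∀ (N : ℕ) (c : FormalRep), N ≠ 0 → N • c ∈ relations → c ∈ relations)
    (hG : ∀ d ∈ G, ∃ N : ℕ, N ≠ 0 ∧ ∃ p : MvPolynomial (Fin 3) ℤ,
      (N : FormalPeriodRing) * toFormalPeriod d = aeval v p)
    {c : FormalRep} (hc : c ∈ NonUnitalSubring.closure G) (h0 : eval c = 0) : c ∈ relations := by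
  -- (1) a normal form for `c`
  obtain ⟨N, hN, p, hp⟩ : ∃ N : ℕ, N ≠ 0 ∧ ∃ p : MvPolynomial (Fin 3) ℤ,
      (N : FormalPeriodRing) * toFormalPeriod c = aeval v p := by
    refine NonUnitalSubring.closure_induction (p := fun c _ => ∃ N : ℕ, N ≠ 0 ∧
      ∃ p : MvPolynomial (Fin 3) ℤ, (N : FormalPeriodRing) * toFormalPeriod c = aeval v p)
      (fun d hd => hG d hd) (hasNF_zero v) (fun _ _ _ _ h₁ h₂ => hasNF_add h₁ h₂)
      (fun _ _ h₁ => hasNF_neg h₁) (fun _ _ _ _ h₁ h₂ => hasNF_mul h₁ h₂) hc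
  -- (2) evaluate: `p(x) = N · eval c = 0`
  have hxv : (fun i => evalP (v i)) = x := funext hv
  have h1 : aeval x p = 0 := by
    rw [← hxv, ← evalP_aeval, ← hp, map_mul, map_natCast, evalP_toFormalPeriod, h0, mul_zero]
  -- (3) algebraic independence: `p = 0`
  have h2 : MvPolynomial.map (algebraMap ℤ ℚ) p = 0 := by
    apply hx
    rw [MvPolynomial.aeval_map_algebraMap, map_zero]
    exact h1
  have hp0 : p = 0 :=
    MvPolynomial.map_injective (algebraMap ℤ ℚ) (algebraMap ℤ ℚ).injective_int
      (by rw [h2, map_zero])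
  rw [hp0, map_zero] at hp
  -- (4) `N • c ∈ relations`, and torsion-freeness
  have hNc : toFormalPeriod (N • c) = 0 := by
    rw [map_nsmul, nsmul_eq_mul, hp]
  exact hT N c hN (toFormalPeriod_eq_zero_iff.mp hNc)

/-! ## Transfer of algebraic independence -/

/-- **Transfer of algebraic independence.** If `x : Fin n → L` is algebraically independent over
`K` and every `x i` lies in the field `K(y₀, …, y_{n−1})` generated by another family `y : Fin n → L`,
then `y` is algebraically independent: `n ≤ trdeg_K K(y)`
(`Grothendieck.le_trdeg_adjoin_of_algebraicIndependent`) and `n` generators of a field of transcendence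
degree `≥ n` form a transcendence basis
(`Literature.Barriers.Schanuel.algebraicIndependent_of_le_trdeg_adjoin`). [folklore] -/
theorem algebraicIndependent_of_mem_adjoin {K L : Type*} [Field K] [Field L] [Algebra K L] {n : ℕ}
    {x y : Fin n → L} (hx : AlgebraicIndependent K x)
    (h : ∀ i, x i ∈ adjoin K (Set.range y)) : AlgebraicIndependent K y :=
  Literature.Barriers.Schanuel.algebraicIndependent_of_le_trdeg_adjoin y
    (Summit.KontsevichZagierPeriods.Grothendieck.le_trdeg_adjoin_of_algebraicIndependent (Set.range y) x hx h)

end Summit.KontsevichZagierPeriods.GenusOneIterated.LemniscaticSectorKernel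

end
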